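import Summits.CriticalPhenomena.CardyFormulaZ2.Theorems.CardyComplexConeEdgePrecompactUFRSStrandsArmsPieces

/-!
# Strands ⇒ arms, II: what the perturbed pieces miss (mesh `1`)
(line `qkz-strip-boundary-arm` of crux `CardyComplexCone.EdgePrecompact`, stmt-CriticalPhenomena-11387;
planar bookkeeping for the registered sub-goal `ufrs_strands_zdDomArms`)

Continuation of `…UFRSStrandsArmsPieces.lean`. The pieces `[pieceVert β q j, pieceVert β q (j+1)]`
of the perturbed polyline of an orbit of `nextCorner β` are the dart pieces `cyDart` (even `j`)
and connectors `cyConn` (odd `j`) of `MedialCycleSeparation.lean`, so they miss lattice points,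
face centres, the half-diagonals of other corners and the lattice edges open in `β`
(`toComplex_not_mem_piece`, `faceCenter_not_mem_piece`, `eq_of_mem_piece_halfDiag`,
`openEdge_not_mem_piece`). New here: they also miss the DUAL STEPS across edges closed in `β` —
the centre-to-centre segment `[centre (cFace p), centre (faceAt v (k+1))] = v + I^k · [(1+i)/2, (-1+i)/2]`
of a corner `p = (v, k)` with `cTgt p ∉ β` (`crossSeg_not_mem_piece`), by three further rows
`std_DX`, `std_VX`, `std_FX` of the intersection table of `MedialCycleTurning.lean` (a face
connector meets a crossing segment only if the crossed edge is the followed, open, edge).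
These are the facts that keep the open arm on the left of a strand and the dual arm on its right
inside one complementary component of the perturbed polylines.

References: S. Smirnov, C. R. Acad. Sci. Paris 333 (2001), §2; G. Grimmett, *Percolation* (1999),
§11.2 (planar duality).
-/

namespace Summit.CriticalPhenomena.CardyFormulaZ2.Cruxes.EdgePrecompact.QkzStripBoundaryArm

open MeasureTheory Filter Set Metric Complex
open scoped Topology BigOperators Pointwise
open Literature.Probability.LatticeModels Literature.Probability.Percolation
open Literature.Probability.RandomPlanarGeometry (DobrushinDomain)
open Summit.CriticalPhenomena.CardyFormulaZ2.Theses.CardyComplexCone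

noncomputable section

/-! ## Pieces are the dart pieces / connectors of `MedialCycleSeparation`; what they miss -/

/-- The even pieces are the dart pieces `cyDart`. -/
theorem piece_even_eq_cyDart (β : BondConfig (Site 2)) (q : Site 2 × Fin 4) (m : ℕ) :
    segment ℝ (pieceVert β q (2 * m)) (pieceVert β q (2 * m + 1)) = cyDart β q m := by
  rw [pieceVert_even, pieceVert_odd, cyDart, cyS_eq_sPt, cyT_eq_tPt]

/-- The odd pieces are the connectors `cyConn`. -/
theorem piece_odd_eq_cyConn (β : BondConfig (Site 2)) (q : Site 2 × Fin 4) (m : ℕ) :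
    segment ℝ (pieceVert β q (2 * m + 1)) (pieceVert β q (2 * m + 1 + 1)) = cyConn β q m := by
  rw [show 2 * m + 1 + 1 = 2 * (m + 1) by ring, pieceVert_odd, pieceVert_even, cyConn, cyS_eq_sPt, cyT_eq_tPt]

/-- **Lattice points miss every piece.** -/
theorem toComplex_not_mem_piece (β : BondConfig (Site 2)) (q : Site 2 × Fin 4) (u : Site 2) (j : ℕ) :
    Site.toComplex u ∉ segment ℝ (pieceVert β q j) (pieceVert β q (j + 1)) := by
  obtain ⟨m, rfl | rfl⟩ := Nat.even_or_odd' j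
  · rw [piece_even_eq_cyDart]; exact toComplex_not_mem_cyDart u m
  · rw [piece_odd_eq_cyConn]; exact toComplex_not_mem_cyConn u m

/-- **Face centres miss every piece.** -/
theorem faceCenter_not_mem_piece (β : BondConfig (Site 2)) (q : Site 2 × Fin 4) (g : Site 2) (j : ℕ) :
    faceCenter g ∉ segment ℝ (pieceVert β q j) (pieceVert β q (j + 1)) := by
  obtain ⟨m, rfl | rfl⟩ := Nat.even_or_odd' j
  · rw [piece_even_eq_cyDart]; exact faceCenter_not_mem_cyDart g m
  · rw [piece_odd_eq_cyConn]; exact faceCenter_not_mem_cyConn g m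

/-- **A piece meets the half-diagonal of a corner only if it is the dart piece of that corner.** -/
theorem eq_of_mem_piece_halfDiag (β : BondConfig (Site 2)) (q : Site 2 × Fin 4) {v : Site 2} {k : Fin 4} {j : ℕ}
    {z : ℂ} (hz : z ∈ segment ℝ (pieceVert β q j) (pieceVert β q (j + 1))) (hz' : z ∈ halfDiag v (faceAt v k)) :
    ∃ m, j = 2 * m ∧ cornerOrbit β q m = (v, k) := by
  obtain ⟨m, rfl | rfl⟩ := Nat.even_or_odd' j
  · rw [piece_even_eq_cyDart] at hz
    exact ⟨m, rfl, cy_eq_of_mem_halfDiag m hz hz'⟩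
  · rw [piece_odd_eq_cyConn] at hz
    exact absurd hz' (cyConn_disjoint_halfDiag m (isCorner_faceAt v k) hz)

/-- The successor map only reads lattice edges of `β`: intersecting `β` with the edge set does
not change orbits. -/
theorem cornerOrbit_inter_edgeSet (β : BondConfig (Site 2)) (q : Site 2 × Fin 4) (t : ℕ) :
    cornerOrbit (β ∩ (zdGraph 2).edgeSet) q t = cornerOrbit β q t := by
  induction t with
  | zero => rfl
  | succ t ih =>
    show nextCorner _ (cornerOrbit _ q t) = nextCorner β (cornerOrbit β q t)
    rw [ih]
    by_cases h : cTgt (cornerOrbit β q t) ∈ β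
    · rw [nextCorner_of_mem h, nextCorner_of_mem (show _ ∈ β ∩ _ from ⟨h, cTgt_mem_edgeSet _⟩)]
    · rw [nextCorner_of_not_mem h, nextCorner_of_not_mem (fun h' => h h'.1)]

/-- **Edges open in `β` miss every piece** (dart pieces miss all lattice edges; a connector meets a
lattice edge only at a vertex turn, across a CLOSED edge). -/
theorem openEdge_not_mem_piece {β : BondConfig (Site 2)} (q : Site 2 × Fin 4) {u w : Site 2}
    (hadj : (zdGraph 2).Adj u w) (huw : s(u, w) ∈ β) {j : ℕ} {z : ℂ}
    (hz : z ∈ segment ℝ (pieceVert β q j) (pieceVert β q (j + 1))) :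
    z ∉ segment ℝ (Site.toComplex u) (Site.toComplex w) := by
  obtain ⟨m, rfl | rfl⟩ := Nat.even_or_odd' j
  · rw [piece_even_eq_cyDart] at hz
    rw [← edgeTrace_mk]
    exact cyDart_disjoint_edgeTrace m hadj hz
  · rw [piece_odd_eq_cyConn] at hz
    have hcy : cyConn (β ∩ (zdGraph 2).edgeSet) q m = cyConn β q m := by
      simp only [cyConn, cyT, cyS, cyV, cyF, cornerOrbit_inter_edgeSet]
    rw [← hcy] at hz
    rw [← edgeTrace_mk]
    exact cyConn_disjoint_edgeTrace inter_subset_right m ⟨huw, hadj⟩ hz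

/-! ## The crossing segment of a corner against the pieces: three more rows of the table

The dual step of a corner `p = (v, k)` crossing its (closed) target edge runs from the centre of
its face to the centre of the next face around `v`: the segment `v + I^k · stdX`,
`stdX = [(1+i)/2, (-1+i)/2]`. -/

/-- Coordinates along the standard crossing segment `[(1+i)/2, (-1+i)/2]`. -/
theorem re_im_of_mem_stdX {x : ℂ} (hx : x ∈ segment ℝ ((1 + I) / 2) ((-1 + I) / 2)) :
    ∃ s : ℝ, 0 ≤ s ∧ s ≤ 1 ∧ x.re = 1 / 2 - s ∧ x.im = 1 / 2 := by
  rw [segment_eq_image'] at hx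
  obtain ⟨s, ⟨hs0, hs1⟩, rfl⟩ := hx
  refine ⟨s, hs0, hs1, ?_, ?_⟩
  · simp only [add_re, sub_re, Complex.smul_re, smul_eq_mul, div_ofNat_re, one_re, I_re, neg_re]; ring
  · simp only [add_im, sub_im, Complex.smul_im, smul_eq_mul, div_ofNat_im, one_im, I_im, neg_im]; ring

/-- Trichotomy of an integer against `0`, in real form (for `linarith`). -/
private theorem int_tri_W3A (a : ℤ) : (a : ℝ) ≤ -1 ∨ (a = 0 ∧ (a : ℝ) = 0) ∨ (1 : ℝ) ≤ a := by
  rcases lt_trichotomy a 0 with h | h | h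
  · left; exact_mod_cast (show a ≤ -1 by omega)
  · exact Or.inr (Or.inl ⟨h, by rw [h]; simp⟩)
  · right; right; exact_mod_cast (show 1 ≤ a by omega)

/-- A site with vanishing coordinates is `0`. -/
private theorem site_eq_zero_W3A {u : Site 2} (h0 : u 0 = 0) (h1 : u 1 = 0) : u = 0 := by
  ext i; fin_cases i <;> simp [h0, h1]

/-- A site from its two coordinates. -/
private theorem site_eq_of_W3A {u : Site 2} {a b : ℤ} (h0 : u 0 = a) (h1 : u 1 = b) : u = ![a, b] := by
  ext i; fin_cases i <;> simp [h0, h1]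

section Table

variable {u : Site 2} {r : Fin 4} {x y : ℂ}

/-- Dart against crossing segment: never. -/
theorem std_DX (hx : x ∈ stdD) (hy : y ∈ segment ℝ ((1 + I) / 2) ((-1 + I) / 2))
    (h : x = Site.toComplex u + I ^ (r : ℕ) * y) : False := by
  obtain ⟨s, hs0, hs1, hxr, hxi⟩ := re_im_of_mem_stdD hx
  obtain ⟨t, ht0, ht1, hyr, hyi⟩ := re_im_of_mem_stdX hy
  rcases reim_cases u r y h with ⟨-, hre, him⟩ | ⟨-, hre, him⟩ | ⟨-, hre, him⟩ | ⟨-, hre, him⟩ <;>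
    rcases int_tri_W3A (u 0) with h0 | ⟨h0, h0'⟩ | h0 <;> rcases int_tri_W3A (u 1) with h1 | ⟨h1, h1'⟩ | h1 <;>
    linarith

/-- Vertex connector against crossing segment: never. -/
theorem std_VX (hx : x ∈ stdV) (hy : y ∈ segment ℝ ((1 + I) / 2) ((-1 + I) / 2))
    (h : x = Site.toComplex u + I ^ (r : ℕ) * y) : False := by
  obtain ⟨s, hs0, hs1, hxr, hxi⟩ := re_im_of_mem_stdV hx
  obtain ⟨t, ht0, ht1, hyr, hyi⟩ := re_im_of_mem_stdX hy
  rcases reim_cases u r y h with ⟨-, hre, him⟩ | ⟨-, hre, him⟩ | ⟨-, hre, him⟩ | ⟨-, hre, him⟩ <;>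
    rcases int_tri_W3A (u 0) with h0 | ⟨h0, h0'⟩ | h0 <;> rcases int_tri_W3A (u 1) with h1 | ⟨h1, h1'⟩ | h1 <;>
    linarith

/-- Face connector against crossing segment: the crossing segment of the same corner, or of the
corner `(v + cornerUnit (k+1), k+2)` with the same target edge. -/
theorem std_FX (hx : x ∈ stdF) (hy : y ∈ segment ℝ ((1 + I) / 2) ((-1 + I) / 2))
    (h : x = Site.toComplex u + I ^ (r : ℕ) * y) : (u = 0 ∧ r = 0) ∨ (u = ![0, 1] ∧ r = 2) := by
  obtain ⟨s, hs0, hs1, hxr, hxi⟩ := re_im_of_mem_stdF hx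
  obtain ⟨t, ht0, ht1, hyr, hyi⟩ := re_im_of_mem_stdX hy
  rcases reim_cases u r y h with ⟨rfl, hre, him⟩ | ⟨rfl, hre, him⟩ | ⟨rfl, hre, him⟩ | ⟨rfl, hre, him⟩ <;>
    rcases int_tri_W3A (u 0) with h0 | ⟨h0, h0'⟩ | h0 <;> rcases int_tri_W3A (u 1) with h1 | ⟨h1, h1'⟩ | h1 <;>
    first
    | (exfalso; linarith)
    | exact Or.inl ⟨site_eq_zero_W3A h0 h1, rfl⟩
    | (right
       refine ⟨site_eq_of_W3A h0 ?_, rfl⟩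
       have h2 : (u 1 : ℝ) < 2 := by linarith
       have h3 : u 1 < 2 := by exact_mod_cast h2
       have h4 : (1 : ℤ) ≤ u 1 := by exact_mod_cast h1
       omega)

end Table

/-- The crossing segment of `p = (v, k)` is `v + I^k · stdX`. -/
theorem mem_cross_iff {p : Site 2 × Fin 4} {z : ℂ} :
    z ∈ segment ℝ (faceCenter (cFace p)) (faceCenter (faceAt p.1 (p.2 + 1))) ↔
      ∃ y ∈ segment ℝ ((1 + I) / 2) ((-1 + I) / 2), z = Site.toComplex p.1 + I ^ (p.2 : ℕ) * y := by
  rw [faceCenter_cFace, faceCenter_faceAt_succ]; exact mem_segment_affine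

/-- **Dart pieces miss every crossing segment.** -/
theorem not_mem_dart_cross {p p' : Site 2 × Fin 4} {z : ℂ} (hz : z ∈ segment ℝ (sPt p') (tPt p'))
    (hz' : z ∈ segment ℝ (faceCenter (cFace p)) (faceCenter (faceAt p.1 (p.2 + 1)))) : False := by
  obtain ⟨x, hx, rfl⟩ := mem_dart_iff.1 hz
  obtain ⟨y, hy, h⟩ := mem_cross_iff.1 hz'
  obtain ⟨u, r, hxy, -, -⟩ := normalize_corner h
  exact std_DX hx hy hxy

/-- **Vertex connectors miss every crossing segment.** -/
theorem not_mem_vconn_cross {p p' : Site 2 × Fin 4} {z : ℂ} (hz : z ∈ segment ℝ (tPt p') (sPt (p'.1, p'.2 + 1)))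
    (hz' : z ∈ segment ℝ (faceCenter (cFace p)) (faceCenter (faceAt p.1 (p.2 + 1)))) : False := by
  obtain ⟨x, hx, rfl⟩ := mem_vconn_iff.1 hz
  obtain ⟨y, hy, h⟩ := mem_cross_iff.1 hz'
  obtain ⟨u, r, hxy, -, -⟩ := normalize_corner h
  exact std_VX hx hy hxy

/-- **A face connector meets a crossing segment only if the crossed edge is the followed edge.** -/
theorem cTgt_eq_of_mem_fconn_cross {p p' : Site 2 × Fin 4} {z : ℂ}
    (hz : z ∈ segment ℝ (tPt p') (sPt (p'.1 + cornerUnit (p'.2 + 1), p'.2 + 3)))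
    (hz' : z ∈ segment ℝ (faceCenter (cFace p)) (faceCenter (faceAt p.1 (p.2 + 1)))) : cTgt p = cTgt p' := by
  obtain ⟨x, hx, rfl⟩ := mem_fconn_iff.1 hz
  obtain ⟨y, hy, h⟩ := mem_cross_iff.1 hz'
  obtain ⟨u, r, hxy, hk, hv⟩ := normalize_corner h
  rcases std_FX hx hy hxy with ⟨hu, hr⟩ | ⟨hu, hr⟩
  · rw [hu, toComplex_zero_site, mul_zero, add_zero] at hv
    rw [hr, add_zero] at hk
    rw [show p = p' from Prod.ext (toComplex_injective_site hv) hk]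
  · rw [hu, toComplex_zero_one, ← toComplex_cornerUnit_succ, ← toComplex_add] at hv
    rw [hr] at hk
    rw [show p = (p'.1 + cornerUnit (p'.2 + 1), p'.2 + 2) from Prod.ext (toComplex_injective_site hv) hk]
    exact cTgt_of_vconn_fconn p'

/-- **The crossing segment of a corner with CLOSED target edge misses every piece** of every
orbit of the same configuration. -/
theorem crossSeg_not_mem_piece {β : BondConfig (Site 2)} (q : Site 2 × Fin 4) {p : Site 2 × Fin 4}
    (hp : cTgt p ∉ β) {j : ℕ} {z : ℂ} (hz : z ∈ segment ℝ (pieceVert β q j) (pieceVert β q (j + 1))) :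
    z ∉ segment ℝ (faceCenter (cFace p)) (faceCenter (faceAt p.1 (p.2 + 1))) := by
  intro hz'
  obtain ⟨m, rfl | rfl⟩ := Nat.even_or_odd' j
  · rw [pieceVert_even, pieceVert_odd] at hz
    exact not_mem_dart_cross hz hz'
  · rw [show 2 * m + 1 + 1 = 2 * m + 2 by ring, pieceVert_odd, pieceVert_odd_succ] at hz
    by_cases hc : cTgt (cornerOrbit β q m) ∈ β
    · rw [nextCorner_of_mem hc] at hz
      exact hp ((cTgt_eq_of_mem_fconn_cross hz hz') ▸ hc)
    · rw [nextCorner_of_not_mem hc] at hz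
      exact not_mem_vconn_cross hz hz'

/-- **Closed dual steps miss the perturbed polylines** (registered sub-goal
`ufrs_crossSegNotMemPiece` of stmt-CriticalPhenomena-11387; the fact that keeps the dual arm on the
right of a strand inside one sector): the crossing segment of a corner whose target edge is closed
in `β` misses every piece of every orbit of `nextCorner β`. -/
theorem ufrs_crossSegNotMemPiece : ∀ (β : BondConfig (Site 2)) (q p : Site 2 × Fin 4) (j : ℕ) (z : ℂ), cTgt p ∉ β → z ∈ segment ℝ (pieceVert β q j) (pieceVert β q (j + 1)) → z ∉ segment ℝ (faceCenter (cFace p)) (faceCenter (faceAt p.1 (p.2 + 1))) :=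
  fun _β q _p _j _z hp hz => crossSeg_not_mem_piece q hp hz

end

end Summit.CriticalPhenomena.CardyFormulaZ2.Cruxes.EdgePrecompact.QkzStripBoundaryArm
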